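import Summits.BirchSwinnertonDyer.BirchSwinnertonDyer.Theorems.KolyvaginDepthDoorMSymbolCertCosetsQ
import HarnessLib

/-!
# Route `KolyvaginDepthDoor`, crux `KolyvaginDepthSupplyKN` (stmt-BirchSwinnertonDyer-22820) —
# DEPTH TABLE v30, KIT 1″ (level `N = q^k · q₂`): M-symbols of `Γ₀(q^k q₂)` indexed by PAIRS
# (prime-power index, prime index), `ℙ¹(ℤ/q^k q₂) ≅ ℙ¹(ℤ/q^k) × ℙ¹(ℤ/q₂)`

Helper file of the lead prover of line `levelone` (kdd-p1 g35; `--supports stmt-BirchSwinnertonDyer-22820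
--as helper`); it closes nothing and BSD is NOT proved by it.

Kit 1′ (`…MSymbolCertCosetsC`, g33) VERBATIM with its first prime factor `q₁` replaced by the prime power `q^k` of
`…MSymbolCertCosetsQ` (index set `{0, …, q^k + q^k/q − 1}`, `idxQ/colQ/mk_eq_mk_colUQ`); the second factor and the
packing `pairC q₂ i₁ i₂ = i₁ (q₂ + 1) + i₂` are kit 1′'s. For the conductors `664 = 8·83`, `916 = 4·229`, `944 = 16·59`.
* §1 computable `idxCQN`, `actCQN`, `sCQN`, `uCQN`, `iotaCQN`, `chainIdxCQ`, `chainSumCQ`;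
* §2 (`q ≠ q₂` primes) `idxCQ`, `colCQ` (CRT), `colUCQ`, `mk_eq_mk_colUCQ`, `eCQ` (the coset of an index), `mk_eq_eCQ`,
  `exists_rep_eCQ`, `actIdxCQ`, `actP_eCQ_adjugate`, `inv_smul_eCQ`, `idxCQ_lt`; agreement `idxCQN_eq_idxCQ`, `actCQN_eq`,
  `sCQN_eq`, `uCQN_eq`, `iotaCQN_eq`.
(The relations in index form are in the sibling `…MSymbolCertRelationsCQ`.)

References: [CremonaAlgorithms1997] §2.2 (Prop. 2.2.1), §2.4; [PopaZagier2017] Thm. 1, §5.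
-/

set_option linter.dupNamespace false

noncomputable section

open scoped MatrixGroups ModularForm
open CongruenceSubgroup ModularGroup Matrix
open Literature.NumberTheory.EllipticCurves Literature.NumberTheory.EllipticCurves.ModularForms

namespace Summit.BirchSwinnertonDyer.BirchSwinnertonDyer.Theorems.KolyvaginDepthDoor.MSymbolCert

/-! ## §1 The computable layer -/

section CQDefs

variable (q k q₂ : ℕ)

/-- The index of the integer column `(a, c)` modulo `q^k q₂`: the packed pair of the kit-1″ index at `q^k` and the
kit-3 index `idxN` at `q₂`. [cite: CremonaAlgorithms1997, §2.2] -/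
def idxCQN (a c : ℤ) : ℕ := pairC q₂ (idxQN q k a c) (idxN q₂ a c)

/-- Componentwise action of an integer matrix (as a quadruple) on packed pairs. [cite: PopaZagier2017, §5] -/
def actCQN (B : ℤ × ℤ × ℤ × ℤ) (i : ℕ) : ℕ := pairC q₂ (actQN q k B (fstC q₂ i)) (actN q₂ B (sndC q₂ i))

/-- Two-term partner (`adj S = (0 1; -1 0)`). [folklore] -/
def sCQN (i : ℕ) : ℕ := actCQN q k q₂ (0, 1, -1, 0) i

/-- Three-term partner (`adj (TS) = (0 1; -1 1)`). [folklore] -/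
def uCQN (i : ℕ) : ℕ := actCQN q k q₂ (0, 1, -1, 1) i

/-- Conjugation partner (pair of `iotaQN`, `iotaN`). [folklore] -/
def iotaCQN (i : ℕ) : ℕ := pairC q₂ (iotaQN q k (fstC q₂ i)) (iotaN q₂ (sndC q₂ i))

/-- Manin-trick chain of pair indices (as kit 3's `chainIdx`, emitting `idxCQN`). [cite: CremonaAlgorithms1997, §2.3] -/
def chainIdxCQ : ℕ → ℤ → ℤ → List ℕ
  | 0, _, _ => []
  | fuel + 1, z, w => if z = 0 then [] else idxCQN q k q₂ (w % z) (-z) :: chainIdxCQ fuel (w % z) (-z)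

/-- The kernel's chain value `∑_{i ∈ chain} φ(i)` at the level `q^k q₂`. [folklore] -/
def chainSumCQ (φ : ℕ → ℤ) (fuel : ℕ) (z w : ℤ) : ℤ := ((chainIdxCQ q k q₂ fuel z w).map φ).sum

end CQDefs

/-! ## §2 `ℙ¹(ℤ/q^k q₂)` by pairs -/

section CQPrime

variable (q k q₂ : ℕ) [hq : Fact q.Prime] [h₂ : Fact q₂.Prime] [hne : Fact (q ≠ q₂)]

/-- `q^k` and `q₂` are coprime. [folklore] -/
theorem coprimeCQ : Nat.Coprime (q ^ k) q₂ := ((Nat.coprime_primes hq.out h₂.out).mpr hne.out).pow_left k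

/-- The level `q^k q₂` is non-zero. [folklore] -/
instance neZero_mulCQ : NeZero (q ^ k * q₂) := ⟨Nat.mul_ne_zero (NeZero.ne (q ^ k)) h₂.out.ne_zero⟩

/-- Reduction `ℤ/q^k q₂ → ℤ/q^k`. [folklore] -/
def r₁Q : ZMod (q ^ k * q₂) →+* ZMod (q ^ k) := ZMod.castHom (dvd_mul_right (q ^ k) q₂) (ZMod (q ^ k))

/-- Reduction `ℤ/q^k q₂ → ℤ/q₂`. [folklore] -/
def r₂Q : ZMod (q ^ k * q₂) →+* ZMod q₂ := ZMod.castHom (dvd_mul_left q₂ (q ^ k)) (ZMod q₂)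

/-- The Chinese remainder isomorphism. [folklore] -/
def crtQ : ZMod (q ^ k * q₂) ≃+* ZMod (q ^ k) × ZMod q₂ := ZMod.chineseRemainder (coprimeCQ q k q₂)

/-- The components of the CRT isomorphism are the two reductions. [folklore] -/
theorem crtQ_apply (x : ZMod (q ^ k * q₂)) : crtQ q k q₂ x = (r₁Q q k q₂ x, r₂Q q k q₂ x) := by
  change (ZMod.cast x : ZMod (q ^ k) × ZMod q₂) = _
  ext
  · rw [Prod.fst_zmod_cast]; rfl
  · rw [Prod.snd_zmod_cast]; rfl

/-- Two residues mod `q^k q₂` with the same reductions are equal. [folklore] -/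
theorem eq_of_rQ_eq {x y : ZMod (q ^ k * q₂)} (e₁ : r₁Q q k q₂ x = r₁Q q k q₂ y) (e₂ : r₂Q q k q₂ x = r₂Q q k q₂ y) :
    x = y := by
  apply (crtQ q k q₂).injective
  rw [crtQ_apply, crtQ_apply, e₁, e₂]

omit hq h₂ hne in
/-- `r₁Q` of an integer. [folklore] -/
@[simp] theorem r₁Q_intCast (a : ℤ) : r₁Q q k q₂ (a : ZMod (q ^ k * q₂)) = (a : ZMod (q ^ k)) := map_intCast _ a

omit hq hne in
/-- `r₂Q` of an integer. [folklore] -/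
@[simp] theorem r₂Q_intCast (a : ℤ) : r₂Q q k q₂ (a : ZMod (q ^ k * q₂)) = (a : ZMod q₂) := map_intCast _ a

/-- **The index of the column `(a, c)` modulo `q^k q₂`**: the packed pair of the indices of its reductions.
[cite: CremonaAlgorithms1997, §2.2] -/
def idxCQ (a c : ZMod (q ^ k * q₂)) : ℕ :=
  pairC q₂ (idxQ q k (r₁Q q k q₂ a) (r₁Q q k q₂ c)) (idxZ q₂ (r₂Q q k q₂ a) (r₂Q q k q₂ c))

omit hne in
/-- `idxCQ < (q^k + q^k/q)(q₂ + 1)`. [folklore] -/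
theorem idxCQ_lt (a c : ZMod (q ^ k * q₂)) : idxCQ q k q₂ a c < (q ^ k + q ^ k / q) * (q₂ + 1) := by
  unfold idxCQ pairC
  have ha := idxQ_lt q k (r₁Q q k q₂ a) (r₁Q q k q₂ c)
  have hb := idxZ_le q₂ (r₂Q q k q₂ a) (r₂Q q k q₂ c)
  nlinarith

/-- **The column of an index**: the CRT lift of `colQ q k i₁`, `colZ q₂ i₂`. [cite: CremonaAlgorithms1997, §2.2] -/
def colCQ (i : ℕ) : Fin 2 → ZMod (q ^ k * q₂) := fun j =>
  (crtQ q k q₂).symm (colQ q k (fstC q₂ i) j, colZ q₂ (sndC q₂ i) j)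

/-- Reduction of `colCQ` mod `q^k`. [folklore] -/
theorem r₁Q_colCQ (i : ℕ) (j : Fin 2) : r₁Q q k q₂ (colCQ q k q₂ i j) = colQ q k (fstC q₂ i) j := by
  have h := (crtQ q k q₂).apply_symm_apply (colQ q k (fstC q₂ i) j, colZ q₂ (sndC q₂ i) j)
  rw [crtQ_apply] at h
  exact congrArg Prod.fst h

/-- Reduction of `colCQ` mod `q₂`. [folklore] -/
theorem r₂Q_colCQ (i : ℕ) (j : Fin 2) : r₂Q q k q₂ (colCQ q k q₂ i j) = colZ q₂ (sndC q₂ i) j := by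
  have h := (crtQ q k q₂).apply_symm_apply (colQ q k (fstC q₂ i) j, colZ q₂ (sndC q₂ i) j)
  rw [crtQ_apply] at h
  exact congrArg Prod.snd h

/-- A pair of residues mod `q^k q₂` is unimodular as soon as both reductions are. [folklore] -/
theorem isCoprime_of_rQ {x y : ZMod (q ^ k * q₂)} (c₁ : IsCoprime (r₁Q q k q₂ x) (r₁Q q k q₂ y))
    (c₂ : IsCoprime (r₂Q q k q₂ x) (r₂Q q k q₂ y)) : IsCoprime x y := by
  obtain ⟨a₁, b₁, hab₁⟩ := c₁
  obtain ⟨a₂, b₂, hab₂⟩ := c₂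
  refine ⟨(crtQ q k q₂).symm (a₁, a₂), (crtQ q k q₂).symm (b₁, b₂), ?_⟩
  apply (crtQ q k q₂).injective
  rw [map_add, map_mul, map_mul, (crtQ q k q₂).apply_symm_apply, (crtQ q k q₂).apply_symm_apply, map_one,
    crtQ_apply, crtQ_apply]
  ext <;> simp [hab₁, hab₂]

/-- `colCQ i` is unimodular. [folklore] -/
theorem isCoprime_colCQ (i : ℕ) : IsCoprime (colCQ q k q₂ i 0) (colCQ q k q₂ i 1) := by
  refine isCoprime_of_rQ q k q₂ ?_ ?_
  · rw [r₁Q_colCQ, r₁Q_colCQ]; exact isCoprime_colQ q k _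
  · rw [r₂Q_colCQ, r₂Q_colCQ]; exact isCoprime_colZ q₂ _

/-- `colCQ i` as a unimodular column. [folklore] -/
def colUCQ (i : ℕ) : UniCol (q ^ k * q₂) := ⟨colCQ q k q₂ i, isCoprime_colCQ q k q₂ i⟩

/-- **Every unimodular column mod `q^k q₂` is equivalent to the column of its index** (CRT + `mk_eq_mk_colUQ` at `q^k`,
kit 1's `mk_eq_mk_colU` at `q₂`). [cite: CremonaAlgorithms1997, §2.2 Prop. 2.2.1] -/
theorem mk_eq_mk_colUCQ (v : UniCol (q ^ k * q₂)) :
    P1.mk v = P1.mk (colUCQ q k q₂ (idxCQ q k q₂ (v.1 0) (v.1 1))) := by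
  rw [P1.mk_eq_mk_iff]
  change v.1 0 * colCQ q k q₂ _ 1 = v.1 1 * colCQ q k q₂ _ 0
  have hv₁ : IsCoprime (r₁Q q k q₂ (v.1 0)) (r₁Q q k q₂ (v.1 1)) := v.2.map (r₁Q q k q₂)
  have hv₂ : IsCoprime (r₂Q q k q₂ (v.1 0)) (r₂Q q k q₂ (v.1 1)) := v.2.map (r₂Q q k q₂)
  have k₁ := (P1.mk_eq_mk_iff _ _).mp (mk_eq_mk_colUQ q k ⟨![r₁Q q k q₂ (v.1 0), r₁Q q k q₂ (v.1 1)], hv₁⟩)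
  have k₂ := (P1.mk_eq_mk_iff _ _).mp (mk_eq_mk_colU q₂ ⟨![r₂Q q k q₂ (v.1 0), r₂Q q k q₂ (v.1 1)], hv₂⟩)
  simp only [colUQ, colU, Matrix.cons_val_zero, Matrix.cons_val_one, Matrix.cons_val_fin_one] at k₁ k₂
  have i₂le : idxZ q₂ (r₂Q q k q₂ (v.1 0)) (r₂Q q k q₂ (v.1 1)) ≤ q₂ := idxZ_le q₂ _ _
  refine eq_of_rQ_eq q k q₂ ?_ ?_
  · rw [map_mul, map_mul, r₁Q_colCQ, r₁Q_colCQ, idxCQ, fstC_pairC q₂ i₂le]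
    exact k₁
  · rw [map_mul, map_mul, r₂Q_colCQ, r₂Q_colCQ, idxCQ, sndC_pairC q₂ i₂le]
    exact k₂

/-- **`eCQ i`: the coset of `SL₂(ℤ)/Γ₀(q^k q₂)` of index `i`** (through the tree's `cosetEquivP1`).
[cite: CremonaAlgorithms1997, §2.2] -/
def eCQ (i : ℕ) : Gamma0Coset (q ^ k * q₂) := (cosetEquivP1 (q ^ k * q₂)).symm (P1.mk (colUCQ q k q₂ i))

/-- `eCQ i ↦ [colCQ i]` under `SL₂(ℤ)/Γ₀ ≅ ℙ¹`. [folklore] -/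
theorem cosetEquivP1_eCQ (i : ℕ) : cosetEquivP1 (q ^ k * q₂) (eCQ q k q₂ i) = P1.mk (colUCQ q k q₂ i) :=
  (cosetEquivP1 (q ^ k * q₂)).apply_symm_apply _

/-- **Every coset is an `eCQ i`**: `gΓ₀ = eCQ (idxCQ ḡ₀₀ ḡ₁₀)`. [cite: CremonaAlgorithms1997, §2.2 Prop. 2.2.1] -/
theorem mk_eq_eCQ (g : SL(2, ℤ)) :
    ((g : Gamma0Coset (q ^ k * q₂))) =
      eCQ q k q₂ (idxCQ q k q₂ ((g 0 0 : ℤ) : ZMod (q ^ k * q₂)) ((g 1 0 : ℤ) : ZMod (q ^ k * q₂))) := by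
  apply (cosetEquivP1 (q ^ k * q₂)).injective
  rw [cosetEquivP1_mk, cosetEquivP1_eCQ, colP, mk_eq_mk_colUCQ]
  rfl

/-- A representative of `eCQ i` with first column EQUAL to `colCQ i`. [folklore] -/
theorem exists_rep_eCQ (i : ℕ) : ∃ g : SL(2, ℤ), firstCol (q ^ k * q₂) g = colUCQ q k q₂ i ∧
    ((g : Gamma0Coset (q ^ k * q₂))) = eCQ q k q₂ i := by
  obtain ⟨g, hg⟩ := exists_firstCol_eq (q ^ k * q₂) (colUCQ q k q₂ i)
  refine ⟨g, hg, (cosetEquivP1 (q ^ k * q₂)).injective ?_⟩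
  rw [cosetEquivP1_mk, cosetEquivP1_eCQ, colP, hg]

/-- The index of `[B̄ · colCQ i]`. [cite: PopaZagier2017, §5] -/
def actIdxCQ (B : Matrix (Fin 2) (Fin 2) ℤ) (i : ℕ) : ℕ :=
  idxCQ q k q₂ ((redMat (q ^ k * q₂) B *ᵥ colCQ q k q₂ i) 0) ((redMat (q ^ k * q₂) B *ᵥ colCQ q k q₂ i) 1)

/-- **`actP (eCQ i) (adj B) = eCQ (actIdxCQ B i)`** for `det B` prime to `q^k q₂`. [cite: PopaZagier2017, §5] -/
theorem actP_eCQ_adjugate {B : Matrix (Fin 2) (Fin 2) ℤ} (hB : IsUnit ((B.det : ℤ) : ZMod (q ^ k * q₂))) (i : ℕ) :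
    actP (q ^ k * q₂) (eCQ q k q₂ i) B.adjugate = eCQ q k q₂ (actIdxCQ q k q₂ B i) := by
  have hB' : IsUnit (redMat (q ^ k * q₂) B).det := (isUnit_det_redMat_iff (q ^ k * q₂) B).mpr hB
  apply (cosetEquivP1 (q ^ k * q₂)).injective
  rw [cosetEquivP1_actP_adjugate, cosetEquivP1_eCQ, cosetEquivP1_eCQ, smulP1_mk (q ^ k * q₂) hB', actIdxCQ]
  exact mk_eq_mk_colUCQ q k q₂ _

/-- **`γ⁻¹ • eCQ i = eCQ (actIdxCQ (adj γ) i)`** for `γ ∈ SL₂(ℤ)`. [cite: PopaZagier2017, §5] -/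
theorem inv_smul_eCQ (γ : SL(2, ℤ)) (i : ℕ) :
    γ⁻¹ • eCQ q k q₂ i = eCQ q k q₂ (actIdxCQ q k q₂ (γ : Matrix (Fin 2) (Fin 2) ℤ).adjugate i) := by
  have hadj : ((γ : Matrix (Fin 2) (Fin 2) ℤ).adjugate).adjugate = (γ : Matrix (Fin 2) (Fin 2) ℤ) := by
    rw [Matrix.adjugate_adjugate _ (by simp)]
    simp
  have hdet : IsUnit ((((γ : Matrix (Fin 2) (Fin 2) ℤ).adjugate).det : ℤ) : ZMod (q ^ k * q₂)) := by
    rw [Matrix.det_adjugate, γ.det_coe]; simp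
  rw [← actP_coe, ← hadj, actP_eCQ_adjugate q k q₂ hdet, hadj]

/-! ### The computable layer agrees -/

omit hne in
/-- **`idxCQN = idxCQ`** (`idxQN_eq_idxQ` at `q^k`, kit 3's `idxN_eq_idxZ` at `q₂`). [folklore] -/
theorem idxCQN_eq_idxCQ (a c : ℤ) :
    idxCQN q k q₂ a c = idxCQ q k q₂ (a : ZMod (q ^ k * q₂)) (c : ZMod (q ^ k * q₂)) := by
  unfold idxCQN idxCQ
  rw [idxQN_eq_idxQ, idxN_eq_idxZ, r₁Q_intCast, r₁Q_intCast, r₂Q_intCast, r₂Q_intCast]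

/-- Reduction of `B̄ · colCQ i` mod `q^k` is `B̄ · colQ q k i₁`. [folklore] -/
theorem r₁Q_mulVec_colCQ (B : Matrix (Fin 2) (Fin 2) ℤ) (i : ℕ) (j : Fin 2) :
    r₁Q q k q₂ ((redMat (q ^ k * q₂) B *ᵥ colCQ q k q₂ i) j) = (redMat (q ^ k) B *ᵥ colQ q k (fstC q₂ i)) j := by
  simp only [Matrix.mulVec, dotProduct, Fin.sum_univ_two, map_add, map_mul, r₁Q_colCQ]
  simp [redMat, r₁Q]

/-- Reduction of `B̄ · colCQ i` mod `q₂` is `B̄ · colZ q₂ i₂`. [folklore] -/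
theorem r₂Q_mulVec_colCQ (B : Matrix (Fin 2) (Fin 2) ℤ) (i : ℕ) (j : Fin 2) :
    r₂Q q k q₂ ((redMat (q ^ k * q₂) B *ᵥ colCQ q k q₂ i) j) = (redMat q₂ B *ᵥ colZ q₂ (sndC q₂ i)) j := by
  simp only [Matrix.mulVec, dotProduct, Fin.sum_univ_two, map_add, map_mul, r₂Q_colCQ]
  simp [redMat, r₂Q]

/-- **`actCQN = actIdxCQ`** on the matrix of the quadruple (`actQN_eq` at `q^k`, kit 3's `actN_eq` at `q₂`). [folklore] -/
theorem actCQN_eq (B : ℤ × ℤ × ℤ × ℤ) (i : ℕ) : actCQN q k q₂ B i = actIdxCQ q k q₂ (toMat B) i := by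
  unfold actCQN actIdxCQ idxCQ
  rw [actQN_eq, actN_eq, actIdxQ, actIdx, r₁Q_mulVec_colCQ, r₁Q_mulVec_colCQ, r₂Q_mulVec_colCQ, r₂Q_mulVec_colCQ]

/-- `sCQN i` is the two-term partner index. [folklore] -/
theorem sCQN_eq (i : ℕ) : sCQN q k q₂ i = actIdxCQ q k q₂ (S : Matrix (Fin 2) (Fin 2) ℤ).adjugate i := by
  rw [sCQN, actCQN_eq]; congr 1
  simp [toMat, ModularGroup.S, Matrix.adjugate_fin_two]

/-- `uCQN i` is the three-term partner index. [folklore] -/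
theorem uCQN_eq (i : ℕ) :
    uCQN q k q₂ i = actIdxCQ q k q₂ ((T : Matrix (Fin 2) (Fin 2) ℤ) * (S : Matrix (Fin 2) (Fin 2) ℤ)).adjugate i := by
  rw [uCQN, actCQN_eq]; congr 1
  simp [toMat, ModularGroup.S, ModularGroup.T, Matrix.adjugate_fin_two]

/-- `iotaCQN i` is the index of the conjugate column `(x, -y)` of `colCQ i = (x, y)`. [folklore] -/
theorem iotaCQN_eq (i : ℕ) : iotaCQN q k q₂ i = idxCQ q k q₂ (colCQ q k q₂ i 0) (-(colCQ q k q₂ i 1)) := by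
  unfold iotaCQN idxCQ
  rw [iotaQN_eq, iotaN_eq, iotaIdxQ, iotaIdx, map_neg, map_neg, r₁Q_colCQ, r₁Q_colCQ, r₂Q_colCQ, r₂Q_colCQ]

end CQPrime

end Summit.BirchSwinnertonDyer.BirchSwinnertonDyer.Theorems.KolyvaginDepthDoor.MSymbolCert

end
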